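import Summits.Ventures.PercRepro.Night2T3C6Q4M0B
import Summits.Ventures.PercRepro.Night2T3C7Q4M0Z
import Summits.Ventures.PercRepro.Night2T3C8Q4M0Z
import Summits.Ventures.PercRepro.Night2T3C9Q4M0Z
import Summits.Ventures.PercRepro.Night2T3C10Q4M0Z
import Summits.Ventures.PercRepro.Night2T3C11Q4M0Z

/-!
# PercRepro — THEOREM R4 (self-contained for `q = 4`): the type-`3` balance on every coloop-free rank-`4` set of `≤ 15` points
(night-2 gen 3, NIGHT-2-profile.md §3i) — imports only the `q = 4` certificate files (coranks 6–11), not the all-`q` assemblies.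
-/
namespace PercRepro.Star

open Finset ThmH SixFour GenQ

variable {α : Type*} [DecidableEq α] {M : Matroid α} [M.Finite]

/-- **THEOREM R4** (`q = 4` inputs only): `0 ≤ J_3(G)` for every coloop-free rank-`4` set `G` with `|G| ≤ 15` of a simple matroid. -/
theorem Jq_three_nonneg_q4_of_card_le_fifteen' (hs : Simple M) {G : Finset α} (hG : G ⊆ gr M)
    (hrG : M.eRk (G : Set α) = ((4 : ℕ) : ℕ∞)) (hcard : G.card ≤ 15) (hmG : mTr M G = 0) :
    0 ≤ Jq M G 4 3 := by
  rcases Nat.lt_or_ge G.card 8 with h | h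
  · exact Jq_three_nonneg_of_card_le_add_three hs hG hrG le_rfl (by omega)
  obtain h8 | h9 | h10 | h11 | h12 | h13 | h14 | h15 :
      G.card = 8 ∨ G.card = 9 ∨ G.card = 10 ∨ G.card = 11 ∨ G.card = 12 ∨ G.card = 13 ∨
        G.card = 14 ∨ G.card = 15 := by omega
  · exact Jq_three_nonneg_of_card_eq_add_four hs hG hrG le_rfl h8
  · exact Jq_three_nonneg_of_card_eq_add_five hs hG hrG le_rfl h9
  · exact Jq_three_nonneg_c6_q4_m0 hs hG hrG h10 hmG
  · exact Jq_three_nonneg_c7_q4_m0 hs hG hrG h11 hmG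
  · exact Jq_three_nonneg_c8_q4_m0 hs hG hrG h12 hmG
  · exact Jq_three_nonneg_c9_q4_m0 hs hG hrG h13 hmG
  · exact Jq_three_nonneg_c10_q4_m0 hs hG hrG h14 hmG
  · exact Jq_three_nonneg_c11_q4_m0 hs hG hrG h15 hmG

end PercRepro.Star
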